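/-
Copyright: statement-level skeleton of a published paper (lit-balaban cell, Phase-2 proof seat p10, gen 4). No proof claims
beyond what the kernel checks below.
-/
import Mathlib
import Literature.MathematicalPhysics.QuantumFieldTheory.BalabanImbrieJaffe1984to88.BIJ85Thm711Fibrewise

/-!
# `BalabanImbrieJaffe1984to88.BIJ85SigmaClosedCube` — T. Bałaban, J. Imbrie, A. Jaffe, *Renormalization of the Higgs model:
minimizers, propagators and the stability of mean field theory*, Commun. Math. Phys. **97** (1985) 299–329
[BalabanImbrieJaffe1985]: Sect. 7.1 pp. 321–325 — **the momentum symbols (7.1.7)–(7.1.16) of σ_k(p) on the CLOSED momentum cube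
|p_j| ≤ π, with their removable singularities filled**, and their agreement with the typed symbols at generic momenta (file 1/3 of
the closed-cube completion of Theorem 7.1.1; files 2/3 `BIJ85SigmaClosedCubeZero`, 3/3 `BIJ85Thm711ClosedCube`)

statement-level skeleton of published theorems with citation tags; proofs where landed; nothing here is a claim about
the Yang–Mills mass gap

PDF held: `paper:balaban1985-cmp97-bij-higgs-minimizers` (journal page = PDF page + 298); text layer pp. 321–325 (PDF 23–27)
re-read this session; the formulas are those transcribed (with renders) in r15's `BIJ85MomentumSymbols71` and gen-2/3 of this seat.

CITATION HEADER (lean-in-tree rule).  Part of the lit-balaban TYPED SKELETON (HOME `run/shared/lean/pub/lit-balaban/`); WHAT IS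
REPRODUCED: SKELETON rows **C1.Thm7.1.1** (typed `BIJ85Sect7Statements.Thm711`, p239582) and **C1.Prop7.1.2** (p. 324 [PDF 26]:
*"… (7.1.21) for |p_j| ≤ π … Then Theorem 7.1.1 holds. Proof. It is sufficient to show that there is a constant c > 0 such that
c ≤ σ_k(p) (7.1.22) for all |p_j| ≤ π"*) of `HOME/lit-balaban-r15/ROWS-C1.md` (fold owner r15, referee ref-5); kind
«model-instance, boundary completion».  Gen 3 of this seat (`BIJ85Thm711Fibrewise`, p247834) proved (7.1.22) with an explicit c(d)
at the momenta 0 < |p_i| ≤ π only, because r15's typed eigenvalue v_μ(p) = ∂^{(1)}_μ(p′)/∂_μ(p) (7.1.7) is the junk value 0/0 = 0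
where ∂_μ vanishes (GAPS.md G-C1-03; transcript note T10 of ROWS-C1), whereas print means the continuous extension; p27's Plancherel
bridge `BIJ85Eq712Plancherel.thm711_of_realMomenta` (p248485) needs the bound at ALL dual momenta |p_j| ≤ π of the finite torus, zero
components included.  This file supplies the corrected symbols; file 3/3 proves (7.1.22) for them at every |p_j| ≤ π.

THE CORRECTED SYMBOLS (η = 1/n; shifts l = 2πm, |m_i| ≤ M as in r15's `lShifts`):
* `vC`: v_μ(q) := ηΣ_{j<n} e^{ijηq_μ} — the symbol of the one-dimensional block average.  PROVED: = the printed ∂^{(1)}_μ(q)/∂_μ(q)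
  wherever ∂_μ(q) ≠ 0 (`vC_eq_vSym`, geometric sum) and = 1 where ∂_μ(q) = 0 (`vC_eq_one`) — [6I] = Bałaban, CMP **95** (1984) p. 23:
  *"Because u_k(l) = 0 for l ≠ 0, u_k(0) = 1"* (the tree's `Balaban1983to89.B5Prop11Fiber.vSym` uses the same convention); on the
  closed cube 2/π ≤ |v_μ(q)| ≤ 1 (`two_div_pi_le_norm_vC`, `norm_vC_le_one`; print (7.1.20)); on the shifted closed cube (2M + 1 ≤ n)
  the zero set of ∂_μ(p + l) is exactly {p_μ = 0 ∧ l_μ = 0} (`dSym_shift_eq_zero_iff`);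
* `uC` = Π_μ v_μ (7.1.9); the Q^e-weight u/(v_μv_ν) of (7.1.11) as the PRODUCT Π_{ρ∉{μ,ν}}v_ρ (`qeW`; no division);
* the bracket [δ − ∂∂̄/Δ] of (7.1.14) is r15's `projSym` unchanged (at q = 0, where ∂(q) = 0, it evaluates to δ = the orthogonal
  projection onto ∂(0)^⊥; file 2/3 `projSym_zero`);
* `t1C`/`tau1C` (7.1.14), `aTermC`/`aC` (7.1.16), `phiC` (7.1.10), `tau2C` = gen-2's generic `tau2Kernel` (7.1.15) at these data,
  `sigmaC` = τ₁ + τ₂ (7.1.13); the weighted two-form `gW`; the «regular set» `regSet` (Δ(p + l) ≠ 0 ∀l, φ_μ(p) > 0, N(p) > 0) on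
  which file 3/3 proves continuity; the constant `c711` = gen-3's c(d); the path `fillPath`; the closed cube `ClosedMom` and the
  fibrewise form family `sigmaFormClosed` for r15's `Thm711`.
WHAT IS KERNEL-CHECKED here (zero `sorry`, standard axioms): the `vC` facts above; **agreement at generic momenta** — for every p with
all p_i ≠ 0, |p_i| ≤ π: `tau2C_eq_tau2Sym` (as kernels), `tau1C_form_eq` and `sigmaC_form_eq` (as quadratic forms on two-forms; the
diagonal entries μ = ν, irrelevant for antisymmetric f, differ), the right sides being r15's `tau1Sym`/`tau2Sym` and gen-3's
`BIJ85Thm711Fibrewise.sigmaSym`; Δ(p + l) > 0 at every shift of every p ≠ 0 of the closed cube (`lapSym_shift_pos_of_ne_zero`);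
0 < c(d) ≤ ½ (`c711_pos`, `c711_le_half`).
NOT CLAIMED: the identification of these symbols with the configuration-space σ_k of (4.2.2)/(7.1.12) (p27's lane).  Unit
`lit-balaban-p10` (gen 4), HOME as above.
-/

namespace Literature.MathematicalPhysics.QuantumFieldTheory.BalabanImbrieJaffe1984to88.BIJ85SigmaClosedCube

open scoped BigOperators Real ComplexConjugate Topology Matrix Kronecker
open Finset Filter Matrix
open Literature.MathematicalPhysics.QuantumFieldTheory.BalabanImbrieJaffe1984to88.BIJ85MomentumSymbols71
open Literature.MathematicalPhysics.QuantumFieldTheory.BalabanImbrieJaffe1984to88.BIJ85CurlComplement719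
open Literature.MathematicalPhysics.QuantumFieldTheory.BalabanImbrieJaffe1984to88.BIJ85Tau0Positivity729
open Literature.MathematicalPhysics.QuantumFieldTheory.BalabanImbrieJaffe1984to88.BIJ85Tau2Kernel715
open Literature.MathematicalPhysics.QuantumFieldTheory.BalabanImbrieJaffe1984to88.BIJ85SigmaOnCurls325
open Literature.MathematicalPhysics.QuantumFieldTheory.BalabanImbrieJaffe1984to88.BIJ85AveragingSums716
open Literature.MathematicalPhysics.QuantumFieldTheory.BalabanImbrieJaffe1984to88.BIJ85Prop712Fibre
open Literature.MathematicalPhysics.QuantumFieldTheory.BalabanImbrieJaffe1984to88.BIJ85Thm711Fibrewise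
open Literature.MathematicalPhysics.QuantumFieldTheory.BalabanImbrieJaffe1984to88.BIJ85Sect7Statements

noncomputable section

variable {d : ℕ}

/-! ## §1 The block-averaging symbol v_μ with its removable singularity filled (η = 1/n) -/

/-- z_μ(q) = e^{iηq_μ}, η = 1/n (the phase inside (7.1.4)). [cite: BalabanImbrieJaffe1985, (7.1.4) p.322] -/
def zC (n : ℕ) (q : Fin d → ℝ) (μ : Fin d) : ℂ :=
  Complex.exp (Complex.I * ((((n : ℝ)⁻¹ * q μ : ℝ)) : ℂ))

/-- **(7.1.7) with the removable singularity filled**: v_μ(q) := η Σ_{j<n} e^{ijηq_μ} (η = 1/n) — the symbol of the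
one-dimensional block average; it equals the printed quotient ∂^{(1)}_μ(q′)/∂_μ(q) wherever ∂_μ(q) ≠ 0 (`vC_eq_vSym`) and takes
the value 1 where ∂_μ(q) = 0 (`vC_eq_one`; [6I] = Bałaban CMP 95 p. 23 *"u_k(l) = 0 for l ≠ 0, u_k(0) = 1"*).
[cite: BalabanImbrieJaffe1985, (7.1.7) p.322] -/
def vC (n : ℕ) (q : Fin d → ℝ) (μ : Fin d) : ℂ :=
  ((n : ℂ))⁻¹ * ∑ j ∈ Finset.range n, zC n q μ ^ j

/-- kernel: z_μ(q) − 1 = η·∂_μ(q). [cite: BalabanImbrieJaffe1985, (7.1.4) p.322] -/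
theorem zC_sub_one {n : ℕ} (hn : 0 < n) (q : Fin d → ℝ) (μ : Fin d) :
    zC n q μ - 1 = ((n : ℂ))⁻¹ * dSym ((n : ℝ)⁻¹) q μ := by
  have hn' : (n : ℂ) ≠ 0 := by exact_mod_cast hn.ne'
  rw [dSym, zC, Complex.ofReal_inv, Complex.ofReal_natCast]
  field_simp

/-- kernel: z_μ(q)ⁿ = e^{iq_μ}, so z_μ(q)ⁿ − 1 = ∂^{(1)}_μ(q). [cite: BalabanImbrieJaffe1985, (7.1.5) p.322] -/
theorem zC_pow {n : ℕ} (hn : 0 < n) (q : Fin d → ℝ) (μ : Fin d) : zC n q μ ^ n - 1 = dOne q μ := by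
  have hn' : (n : ℂ) ≠ 0 := by exact_mod_cast hn.ne'
  rw [dOne, zC, ← Complex.exp_nat_mul]
  congr 2
  push_cast
  field_simp

/-- kernel: ∂_μ(q) = 0 iff z_μ(q) = 1. [cite: BalabanImbrieJaffe1985, (7.1.4) p.322] -/
theorem dSym_eq_zero_iff_zC {n : ℕ} (hn : 0 < n) (q : Fin d → ℝ) (μ : Fin d) :
    dSym ((n : ℝ)⁻¹) q μ = 0 ↔ zC n q μ = 1 := by
  have hn' : (n : ℂ) ≠ 0 := by exact_mod_cast hn.ne'
  have h := zC_sub_one hn q μ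
  constructor
  · intro h0
    rw [h0, mul_zero, sub_eq_zero] at h
    exact h
  · intro h1
    rw [h1, sub_self] at h
    have := h.symm
    rwa [mul_eq_zero, inv_eq_zero, or_iff_right hn'] at this

/-- **v_μ = ∂^{(1)}_μ/∂_μ off the zero set of ∂_μ** (geometric sum): the corrected symbol IS the printed (7.1.7) at generic
momenta. [cite: BalabanImbrieJaffe1985, (7.1.7) p.322] -/
theorem vC_eq_vSym {n : ℕ} (hn : 0 < n) {q : Fin d → ℝ} {μ : Fin d} (h : dSym ((n : ℝ)⁻¹) q μ ≠ 0) :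
    vC n q μ = vSym ((n : ℝ)⁻¹) q μ := by
  have hn' : (n : ℂ) ≠ 0 := by exact_mod_cast hn.ne'
  have hz : zC n q μ ≠ 1 := fun h1 => h ((dSym_eq_zero_iff_zC hn q μ).mpr h1)
  rw [vC, geom_sum_eq hz, zC_pow hn, zC_sub_one hn, vSym_eq]
  field_simp

/-- **v_μ = 1 on the zero set of ∂_μ** (all n terms equal 1). [cite: BalabanImbrieJaffe1985, (7.1.7) p.322] -/
theorem vC_eq_one {n : ℕ} (hn : 0 < n) {q : Fin d → ℝ} {μ : Fin d} (h : dSym ((n : ℝ)⁻¹) q μ = 0) : vC n q μ = 1 := by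
  have hn' : (n : ℂ) ≠ 0 := by exact_mod_cast hn.ne'
  rw [vC, (dSym_eq_zero_iff_zC hn q μ).mp h]
  simp [hn']

/-- kernel: |v_μ(q)| ≤ 1 everywhere (|z| = 1). [cite: BalabanImbrieJaffe1985, (7.1.20) p.323] -/
theorem norm_vC_le_one {n : ℕ} (hn : 0 < n) (q : Fin d → ℝ) (μ : Fin d) : ‖vC n q μ‖ ≤ 1 := by
  have hn' : (0 : ℝ) < n := by exact_mod_cast hn
  have hz : ‖zC n q μ‖ = 1 := by rw [zC, Complex.norm_exp_I_mul_ofReal]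
  rw [vC, norm_mul, norm_inv, Complex.norm_natCast]
  calc (n : ℝ)⁻¹ * ‖∑ j ∈ Finset.range n, zC n q μ ^ j‖ ≤ (n : ℝ)⁻¹ * ∑ j ∈ Finset.range n, ‖zC n q μ ^ j‖ :=
        mul_le_mul_of_nonneg_left (norm_sum_le _ _) (inv_nonneg.mpr hn'.le)
    _ = 1 := by simp [norm_pow, hz, hn'.ne']

/-- kernel: v_μ is continuous in q (a trigonometric polynomial). [cite: BalabanImbrieJaffe1985, (7.1.7) p.322] -/
theorem continuous_vC (n : ℕ) (μ : Fin d) : Continuous fun q : Fin d → ℝ => vC n q μ := by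
  unfold vC zC
  refine continuous_const.mul (continuous_finsetSum _ fun j _ => ?_)
  refine Continuous.pow ?_ _
  refine Complex.continuous_exp.comp (continuous_const.mul ?_)
  exact Complex.continuous_ofReal.comp (continuous_const.mul (continuous_apply μ))

/-- kernel: at a momentum of the closed cube |q_μ| ≤ π with n ≥ 1, ∂_μ(q) = 0 iff q_μ = 0. [cite: BalabanImbrieJaffe1985, (7.1.8) p.322] -/
theorem dSym_eq_zero_iff_of_abs_le {n : ℕ} (hn : 0 < n) {q : Fin d → ℝ} {μ : Fin d} (hq : |q μ| ≤ π) :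
    dSym ((n : ℝ)⁻¹) q μ = 0 ↔ q μ = 0 := by
  have hn' : (0 : ℝ) < n := by exact_mod_cast hn
  have hn1 : (1 : ℝ) ≤ n := by exact_mod_cast hn
  have hη : (0 : ℝ) < (n : ℝ)⁻¹ := inv_pos.mpr hn'
  rw [← norm_eq_zero, norm_dSym hη, div_eq_zero_iff, or_iff_left hη.ne', mul_eq_zero, or_iff_right (two_ne_zero),
    abs_eq_zero]
  have hb : |(n : ℝ)⁻¹ * q μ / 2| < π := by
    rw [abs_div, abs_mul, abs_of_pos hη, abs_two]
    have h1 : (n : ℝ)⁻¹ * |q μ| ≤ 1 * |q μ| :=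
      mul_le_mul_of_nonneg_right (inv_le_one_of_one_le₀ hn1) (abs_nonneg _)
    have := Real.pi_pos
    linarith
  rw [Real.sin_eq_zero_iff_of_lt_of_lt (by linarith [abs_lt.mp hb]) (abs_lt.mp hb).2]
  constructor
  · intro h
    have : (n : ℝ)⁻¹ * q μ = 0 := by linarith
    rcases mul_eq_zero.mp this with h' | h'
    · exact absurd h' hη.ne'
    · exact h'
  · intro h; simp [h]


/-- kernel: the corrected v_μ never vanishes on the closed cube: 2/π ≤ |v_μ(q)| for |q_μ| ≤ π — print's (7.1.20) *"for |p_i| ≤ π,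
2/π ≤ |v_μ(p)|"*, now literally including q_μ = 0 (where v_μ = 1). [cite: BalabanImbrieJaffe1985, (7.1.20) p.323] -/
theorem two_div_pi_le_norm_vC {n : ℕ} (hn : 0 < n) {q : Fin d → ℝ} {μ : Fin d} (hq : |q μ| ≤ π) :
    2 / π ≤ ‖vC n q μ‖ := by
  by_cases h0 : q μ = 0
  · rw [vC_eq_one hn ((dSym_eq_zero_iff_of_abs_le hn hq).mpr h0), norm_one, div_le_one Real.pi_pos]
    linarith [Real.pi_gt_three]
  · have hne : dSym ((n : ℝ)⁻¹) q μ ≠ 0 := fun h => h0 ((dSym_eq_zero_iff_of_abs_le hn hq).mp h)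
    rw [vC_eq_vSym hn hne]
    exact (norm_vSym_bounds (inv_pos.mpr (by exact_mod_cast hn)) (inv_le_one_of_one_le₀ (by exact_mod_cast hn)) h0 hq).1

/-- kernel: hence v_μ(q) ≠ 0 on the closed cube. [cite: BalabanImbrieJaffe1985, (7.1.20) p.323] -/
theorem vC_ne_zero {n : ℕ} (hn : 0 < n) {q : Fin d → ℝ} {μ : Fin d} (hq : |q μ| ≤ π) : vC n q μ ≠ 0 := by
  intro h
  have := two_div_pi_le_norm_vC hn hq (n := n)
  rw [h, norm_zero] at this
  linarith [div_pos two_pos Real.pi_pos]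

/-- kernel: ∂_μ depends on the μ-th component only. [cite: BalabanImbrieJaffe1985, (7.1.4) p.322] -/
theorem dSym_congr (η : ℝ) {q q' : Fin d → ℝ} {μ : Fin d} (h : q μ = q' μ) : dSym η q μ = dSym η q' μ := by
  simp [dSym, h]

/-- kernel: ∂^{(1)}_μ(q) = 0 iff q_μ = 0 on the closed cube. [cite: BalabanImbrieJaffe1985, (7.1.5) p.322] -/
theorem dOne_eq_zero_iff_of_abs_le {q : Fin d → ℝ} {μ : Fin d} (hq : |q μ| ≤ π) : dOne q μ = 0 ↔ q μ = 0 := by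
  have h := dSym_eq_zero_iff_of_abs_le (d := d) (n := 1) one_pos (q := q) (μ := μ) hq
  simpa [dSym_one] using h

/-- **Zero set of ∂_μ on the shifted closed cube**: for |p_μ| ≤ π and a shift l = 2πm with |m_i| ≤ M, 2M + 1 ≤ n (the range
|l_i| ≤ π/η of (7.1.10)): ∂_μ(p + l) = 0 iff p_μ = 0 and l_μ = 0 — the only momenta where the printed quotient v_μ = ∂^{(1)}_μ/∂_μ
is undefined. [cite: BalabanImbrieJaffe1985, (7.1.10) p.322] -/
theorem dSym_shift_eq_zero_iff {n M : ℕ} (hMn : 2 * M + 1 ≤ n) {p : Fin d → ℝ} {μ : Fin d} (hp : |p μ| ≤ π)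
    {m : Fin d → ℤ} (hm : m ∈ lShifts d M) :
    dSym ((n : ℝ)⁻¹) (shiftMom p m) μ = 0 ↔ p μ = 0 ∧ m μ = 0 := by
  have hn : 0 < n := by omega
  constructor
  · intro h
    by_cases hρ : m μ = 0
    · have hq : shiftMom p m μ = p μ := by simp [shiftMom, hρ]
      rw [dSym_congr ((n : ℝ)⁻¹) (q' := p) hq] at h
      exact ⟨(dSym_eq_zero_iff_of_abs_le hn hp).mp h, hρ⟩
    · exfalso
      have h2 := two_mul_abs_le_norm_dSym hMn hp hm hρ
      rw [h, norm_zero] at h2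
      have h1 : (1 : ℝ) ≤ |(m μ : ℝ)| := by
        rw [← Int.cast_abs]; exact_mod_cast Int.one_le_abs hρ
      linarith
  · rintro ⟨h0, hm0⟩
    have hq : shiftMom p m μ = 0 := by simp [shiftMom, h0, hm0]
    simp [dSym, hq]

/-- kernel: Δ(p + l) > 0 at every shift of every p ≠ 0 of the closed cube (η = 1/n). [cite: BalabanImbrieJaffe1985, (7.1.6) p.322] -/
theorem lapSym_shift_pos_of_ne_zero {n : ℕ} (hn : 0 < n) {p : Fin d → ℝ} (hp : ∀ i, |p i| ≤ π) (hp0 : p ≠ 0)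
    (m : Fin d → ℤ) : 0 < lapSym ((n : ℝ)⁻¹) (shiftMom p m) := by
  obtain ⟨ρ, hρ⟩ := Function.ne_iff.mp hp0
  have h1 : dOne p ρ ≠ 0 := fun h => hρ ((dOne_eq_zero_iff_of_abs_le (hp ρ)).mp h)
  have h2 : 0 < ‖dSym ((n : ℝ)⁻¹) (shiftMom p m) ρ‖ := by
    refine lt_of_lt_of_le (norm_pos_iff.mpr h1) ?_
    rw [← dOne_shiftMom p m ρ]
    exact norm_dOne_le_norm_dSym hn _ ρ
  exact lt_of_lt_of_le (pow_pos h2 2) (Finset.single_le_sum (f := fun i => ‖dSym ((n : ℝ)⁻¹) (shiftMom p m) i‖ ^ 2)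
    (fun _ _ => sq_nonneg _) (Finset.mem_univ ρ))

/-- kernel: at a momentum with all components nonzero the corrected and the typed symbols agree at every shift.
[cite: BalabanImbrieJaffe1985, (7.1.7) p.322] -/
theorem vC_shift_eq_vSym {n : ℕ} (hn : 0 < n) {p : Fin d → ℝ} (hp : ∀ i, p i ≠ 0 ∧ |p i| ≤ π) (m : Fin d → ℤ)
    (ρ : Fin d) : vC n (shiftMom p m) ρ = vSym ((n : ℝ)⁻¹) (shiftMom p m) ρ :=
  vC_eq_vSym hn (generic_shift hn hp m ρ).2.1

/-! ## §2 The corrected symbols u, the Q^e-weights, τ₁, a_μ, φ_μ, τ₂ and σ_k(p) on the closed cube -/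

/-- u(q) = Π_μ v_μ(q) with the corrected v ((7.1.9) *"u(p) = det V(p)"*). [cite: BalabanImbrieJaffe1985, (7.1.9) p.322] -/
def uC (n : ℕ) (q : Fin d → ℝ) : ℂ := ∏ ρ, vC n q ρ

/-- The Q^e-weight u/(v_μv_ν) of (7.1.11) written WITHOUT division: Π_{ρ∉{μ,ν}} v_ρ(q) (for μ ≠ ν; the diagonal entries never meet a
two-form). [cite: BalabanImbrieJaffe1985, (7.1.11) p.322] -/
def qeW (n : ℕ) (q : Fin d → ℝ) (μ ν : Fin d) : ℂ := ∏ ρ ∈ (Finset.univ.erase μ).erase ν, vC n q ρ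

/-- The l-term of (7.1.14) with the corrected symbols: \overline{(u/(v_μv_ν))}·(u/(v_λv_κ))·[δ_{μλ} − ∂_μ∂̄_λ/Δ][δ_{νκ} − ∂_ν∂̄_κ/Δ]
at q = p′ + l (the printed weight |u|²/(v̄_μv̄_νv_λv_κ) as a product; the bracket `projSym`, which at q = 0 — where ∂(q) = 0 —
is the identity = the projection onto ∂(0)^⊥). [cite: BalabanImbrieJaffe1985, (7.1.14) p.322] -/
def t1C (n : ℕ) (q : Fin d → ℝ) : Fin d → Fin d → Fin d → Fin d → ℂ :=
  fun μ ν l κ => conj (qeW n q μ ν) * qeW n q l κ * (projSym ((n : ℝ)⁻¹) q μ l * projSym ((n : ℝ)⁻¹) q ν κ)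

/-- **(7.1.14) on the closed cube**: τ₁(p′) = ½Σ_l (l-term)(p′ + l). [cite: BalabanImbrieJaffe1985, (7.1.14) p.322] -/
def tau1C (n M : ℕ) (p : Fin d → ℝ) : Fin d → Fin d → Fin d → Fin d → ℂ :=
  fun μ ν l κ => (1 / 2 : ℂ) * ∑ m ∈ lShifts d M, t1C n (shiftMom p m) μ ν l κ

/-- The l-term (|u/v_μ|²Δ^{−1})(q) of (7.1.16) as the product Π_{ρ≠μ}|v_ρ(q)|²·Δ(q)^{−1}. [cite: BalabanImbrieJaffe1985, (7.1.16) p.323] -/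
def aTermC (n : ℕ) (q : Fin d → ℝ) (μ : Fin d) : ℝ :=
  (∏ ρ ∈ Finset.univ.erase μ, ‖vC n q ρ‖ ^ 2) * (lapSym ((n : ℝ)⁻¹) q)⁻¹

/-- **(7.1.16) on the closed cube**: a_μ(p′) = ∂^{(1)}_μ(p′)Σ_l(|u/v_μ|²Δ^{−1})(p′ + l) (vanishes at p′ = 0).
[cite: BalabanImbrieJaffe1985, (7.1.16) p.323] -/
def aC (n M : ℕ) (p : Fin d → ℝ) (μ : Fin d) : ℂ :=
  dOne p μ * ((∑ m ∈ lShifts d M, aTermC n (shiftMom p m) μ : ℝ) : ℂ)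

/-- **(7.1.10) on the closed cube**: φ_μ(p′) = Σ_l |u(p′+l)v_μ(p′+l)|²Δ(p′+l)^{−1}. [cite: BalabanImbrieJaffe1985, (7.1.10) p.322] -/
def phiC (n M : ℕ) (p : Fin d → ℝ) (μ : Fin d) : ℝ :=
  ∑ m ∈ lShifts d M, ‖uC n (shiftMom p m) * vC n (shiftMom p m) μ‖ ^ 2 * (lapSym ((n : ℝ)⁻¹) (shiftMom p m))⁻¹

/-- **(7.1.15) on the closed cube**: τ₂(p′) = the printed kernel (gen-2 `tau2Kernel`) at a(p′), ∂^{(1)}(p′), φ(p′).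
[cite: BalabanImbrieJaffe1985, (7.1.15) p.323] -/
def tau2C (n M : ℕ) (p : Fin d → ℝ) : Fin d → Fin d → Fin d → Fin d → ℂ :=
  tau2Kernel (aC n M p) (dOne p) (phiC n M p)

/-- **σ_k(p) = τ₁(p) + τ₂(p) on the closed cube** ((7.1.13) with the removable singularities of (7.1.7)–(7.1.16) filled).
[cite: BalabanImbrieJaffe1985, (7.1.13) p.322] -/
def sigmaC (n M : ℕ) (p : Fin d → ℝ) : Fin d → Fin d → Fin d → Fin d → ℂ :=
  fun μ ν l κ => tau1C n M p μ ν l κ + tau2C n M p μ ν l κ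

/-! ## §3 Agreement with the typed symbols at generic momenta (all p_i ≠ 0) -/

/-- kernel: u agrees. [cite: BalabanImbrieJaffe1985, (7.1.9) p.322] -/
theorem uC_shift_eq_uSym {n : ℕ} (hn : 0 < n) {p : Fin d → ℝ} (hp : ∀ i, p i ≠ 0 ∧ |p i| ≤ π) (m : Fin d → ℤ) :
    uC n (shiftMom p m) = uSym ((n : ℝ)⁻¹) (shiftMom p m) := by
  rw [uC, uSym_eq_prod]
  exact Finset.prod_congr rfl fun ρ _ => vC_shift_eq_vSym hn hp m ρ

/-- kernel: a_μ agrees ((7.1.16)). [cite: BalabanImbrieJaffe1985, (7.1.16) p.323] -/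
theorem aC_eq_aSym {n : ℕ} (hn : 0 < n) (M : ℕ) {p : Fin d → ℝ} (hp : ∀ i, p i ≠ 0 ∧ |p i| ≤ π) :
    aC n M p = aSym ((n : ℝ)⁻¹) M p := by
  funext μ
  rw [aC, aSym_eq]
  congr 2
  refine Finset.sum_congr rfl fun m _ => ?_
  rw [aTerm_eq_prod (generic_shift hn hp m μ).2.2, aTermC]
  congr 1
  exact Finset.prod_congr rfl fun ρ _ => by rw [vC_shift_eq_vSym hn hp m ρ]

/-- kernel: φ_μ agrees ((7.1.10)). [cite: BalabanImbrieJaffe1985, (7.1.10) p.322] -/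
theorem phiC_eq_phiSym {n : ℕ} (hn : 0 < n) (M : ℕ) {p : Fin d → ℝ} (hp : ∀ i, p i ≠ 0 ∧ |p i| ≤ π) :
    phiC n M p = phiSym ((n : ℝ)⁻¹) M p := by
  funext μ
  rw [phiC, phiSym]
  refine Finset.sum_congr rfl fun m _ => ?_
  rw [uC_shift_eq_uSym hn hp m, vC_shift_eq_vSym hn hp m μ]

/-- **τ₂ agrees with the typed (7.1.15) at generic momenta** (as kernels). [cite: BalabanImbrieJaffe1985, (7.1.15) p.323] -/
theorem tau2C_eq_tau2Sym {n : ℕ} (hn : 0 < n) (M : ℕ) {p : Fin d → ℝ} (hp : ∀ i, p i ≠ 0 ∧ |p i| ≤ π) :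
    tau2C n M p = tau2Sym ((n : ℝ)⁻¹) M p := by
  rw [tau2C, tau2Sym_eq_kernel, aC_eq_aSym hn M hp, phiC_eq_phiSym hn M hp]

/-- kernel: the division-free weights reproduce the printed |u|²/(v̄_μv̄_νv_λv_κ) off the diagonal when no v_ρ vanishes.
[cite: BalabanImbrieJaffe1985, (7.1.14) p.322] -/
theorem conj_qeW_mul_qeW {n : ℕ} {q : Fin d → ℝ} (hv : ∀ ρ, vC n q ρ ≠ 0) {μ ν l κ : Fin d} (hμν : μ ≠ ν) (hlκ : l ≠ κ) :
    conj (qeW n q μ ν) * qeW n q l κ =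
      (((‖uC n q‖ ^ 2 : ℝ)) : ℂ) / (conj (vC n q μ) * conj (vC n q ν) * vC n q l * vC n q κ) := by
  have hu : ∀ a b : Fin d, a ≠ b → uC n q = vC n q a * vC n q b * qeW n q a b := by
    intro a b hab
    rw [uC, qeW, ← Finset.mul_prod_erase Finset.univ _ (Finset.mem_univ a),
      ← Finset.mul_prod_erase (Finset.univ.erase a) _ (Finset.mem_erase.mpr ⟨Ne.symm hab, Finset.mem_univ b⟩), mul_assoc]
  rw [Complex.ofReal_pow, ← Complex.conj_mul',
    show conj (uC n q) = conj (vC n q μ) * conj (vC n q ν) * conj (qeW n q μ ν) by rw [hu μ ν hμν, map_mul, map_mul],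
    hu l κ hlκ]
  have := hv μ; have := hv ν; have := hv l; have := hv κ
  have : conj (vC n q μ) ≠ 0 := (map_ne_zero _).mpr (hv μ)
  have : conj (vC n q ν) ≠ 0 := (map_ne_zero _).mpr (hv ν)
  field_simp

/-- kernel: off the diagonal, the corrected l-term IS the typed `tau1Term` at generic momenta. [cite: BalabanImbrieJaffe1985, (7.1.14) p.322] -/
theorem t1C_eq_tau1Term {n : ℕ} (hn : 0 < n) {p : Fin d → ℝ} (hp : ∀ i, p i ≠ 0 ∧ |p i| ≤ π) (m : Fin d → ℤ)
    {μ ν l κ : Fin d} (hμν : μ ≠ ν) (hlκ : l ≠ κ) :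
    t1C n (shiftMom p m) μ ν l κ = tau1Term ((n : ℝ)⁻¹) (shiftMom p m) μ ν l κ := by
  have hv : ∀ ρ, vC n (shiftMom p m) ρ ≠ 0 := fun ρ => by
    rw [vC_shift_eq_vSym hn hp m ρ]; exact (generic_shift hn hp m ρ).2.2
  rw [t1C, conj_qeW_mul_qeW hv hμν hlκ, tau1Term, uC_shift_eq_uSym hn hp m]
  simp only [vC_shift_eq_vSym hn hp m]

/-- kernel: a two-form vanishes on the diagonal. [cite: BalabanImbrieJaffe1985, (7.1.19) p.323] -/
theorem twoForm_diag {f : Fin d → Fin d → ℂ} (hf : IsTwoForm f) (μ : Fin d) : f μ μ = 0 :=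
  add_self_eq_zero.mp (eq_neg_iff_add_eq_zero.mp (hf μ μ))

/-- kernel: kernels agreeing off the diagonal define the same quadratic form on two-forms. [cite: BalabanImbrieJaffe1985, (7.1.3) p.321] -/
theorem tensorInner_congr_offDiag {K K' : Fin d → Fin d → Fin d → Fin d → ℂ}
    (hK : ∀ μ ν l κ, μ ≠ ν → l ≠ κ → K μ ν l κ = K' μ ν l κ) {f : Fin d → Fin d → ℂ} (hf : IsTwoForm f) :
    tensorInner f K f = tensorInner f K' f := by
  unfold tensorInner
  refine Finset.sum_congr rfl fun μ _ => Finset.sum_congr rfl fun ν _ => Finset.sum_congr rfl fun l _ =>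
    Finset.sum_congr rfl fun κ _ => ?_
  by_cases hμν : μ = ν
  · subst hμν; simp [twoForm_diag hf]
  by_cases hlκ : l = κ
  · subst hlκ; simp [twoForm_diag hf]
  rw [hK μ ν l κ hμν hlκ]

/-- **τ₁ agrees with the typed (7.1.14) at generic momenta** as a quadratic form on two-forms.
[cite: BalabanImbrieJaffe1985, (7.1.14) p.322] -/
theorem tau1C_form_eq {n : ℕ} (hn : 0 < n) (M : ℕ) {p : Fin d → ℝ} (hp : ∀ i, p i ≠ 0 ∧ |p i| ≤ π)
    {f : Fin d → Fin d → ℂ} (hf : IsTwoForm f) :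
    tensorInner f (tau1C n M p) f = tensorInner f (tau1Sym ((n : ℝ)⁻¹) M p) f := by
  refine tensorInner_congr_offDiag (fun μ ν l κ hμν hlκ => ?_) hf
  rw [tau1C, tau1Sym]
  congr 1
  exact Finset.sum_congr rfl fun m _ => t1C_eq_tau1Term hn hp m hμν hlκ

/-- **σ_k(p) on the closed cube agrees with gen-3's σ_k(p) = τ₁(p) + τ₂(p) (`BIJ85Thm711Fibrewise.sigmaSym`) at every momentum
with all components nonzero**, as a quadratic form on two-forms. [cite: BalabanImbrieJaffe1985, (7.1.13) p.322] -/
theorem sigmaC_form_eq {n : ℕ} (hn : 0 < n) (M : ℕ) {p : Fin d → ℝ} (hp : ∀ i, p i ≠ 0 ∧ |p i| ≤ π)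
    {f : Fin d → Fin d → ℂ} (hf : IsTwoForm f) :
    tensorInner f (sigmaC n M p) f = tensorInner f (sigmaSym ((n : ℝ)⁻¹) M p) f := by
  have h1 := tau1C_form_eq hn M hp hf
  have h2 := tau2C_eq_tau2Sym hn M hp
  unfold sigmaC sigmaSym
  rw [tensorInner_add_kernel, tensorInner_add_kernel, h1, h2]

/-! ## §4 Objects used by files 2/3 and 3/3: weighted two-forms, the regular set, the constant, the path, the closed-cube family -/

/-- The weighted two-form g_{μν} = (u/(v_μv_ν))(q)·f_{μν} entering the l-term. [cite: BalabanImbrieJaffe1985, (7.1.14) p.322] -/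
def gW (n : ℕ) (q : Fin d → ℝ) (f : Fin d → Fin d → ℂ) : Fin d → Fin d → ℂ := fun μ ν => qeW n q μ ν * f μ ν

/-- The regular set of the corrected formulas: every shift has Δ(p + l) ≠ 0, every φ_μ(p) > 0, and N(p) = Σ_ρ|∂^{(1)}_ρ(p)|²/φ_ρ(p)
> 0 — it contains the closed cube minus p′ = 0 (`mem_regSet`, file 3/3). [cite: BalabanImbrieJaffe1985, (7.1.15) p.323] -/
def regSet (n M : ℕ) : Set (Fin d → ℝ) :=
  {p | (∀ m ∈ lShifts d M, lapSym ((n : ℝ)⁻¹) (shiftMom p m) ≠ 0) ∧ (∀ μ, 0 < phiC n M p μ) ∧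
    0 < enn (dOne p) (phiC n M p)}

/-- The constant of gen-3's `thm711_explicit`: c(d) = ¼·min{1,(ε/2dc₂²)²}·ε, ε = ½(2/π)^{2d+4} (`eps730`), c₂² = `cTwoSq d` — a
function of d alone (*"independent of k"*). [cite: BalabanImbrieJaffe1985, Thm. 7.1.1 p.321] -/
def c711 (d : ℕ) : ℝ := 1 / 4 * min 1 ((eps730 d / (2 * (d * cTwoSq d))) ^ 2) * eps730 d

/-- c(d) > 0 (d ≥ 1). [cite: BalabanImbrieJaffe1985, Thm. 7.1.1 p.321] -/
theorem c711_pos (hd : 0 < d) : 0 < c711 d := by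
  have hM : 0 < (d : ℝ) * cTwoSq d := mul_pos (by exact_mod_cast hd) (cTwoSq_pos d)
  have hε := eps730_pos d
  unfold c711
  exact mul_pos (mul_pos (by norm_num) (lt_min zero_lt_one (by positivity))) hε

/-- c(d) ≤ ½ (indeed ≤ ε/4 ≤ 1/8): the fibre p′ = 0, where σ_k(0) ≥ ½, is covered by the same constant.
[cite: BalabanImbrieJaffe1985, Thm. 7.1.1 p.321] -/
theorem c711_le_half (d : ℕ) : c711 d ≤ 1 / 2 := by
  have hε : eps730 d ≤ 1 / 2 := by
    unfold eps730
    have h1 : (2 / π : ℝ) ^ (2 * d + 4) ≤ 1 := by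
      refine pow_le_one₀ (by positivity) ?_
      rw [div_le_one Real.pi_pos]; linarith [Real.pi_gt_three]
    linarith
  have hmin : min 1 ((eps730 d / (2 * (d * cTwoSq d))) ^ 2) ≤ 1 := min_le_left _ _
  have hε0 := (eps730_pos d).le
  unfold c711
  nlinarith [mul_nonneg (sub_nonneg.mpr hmin) hε0]

/-- The path used to reach a boundary momentum from generic ones: the zero components of p are replaced by t.
[cite: BalabanImbrieJaffe1985, (7.1.22) p.324] -/
def fillPath (p : Fin d → ℝ) (t : ℝ) : Fin d → ℝ := fun i => if p i = 0 then t else p i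

/-- The closed momentum cube of p. 321: *"The momenta p have d components p_i, and |p_i| ≤ π"* — ALL of it.
[cite: BalabanImbrieJaffe1985, (7.1.2) p.321] -/
def ClosedMom (d : ℕ) : Type := {p : Fin d → ℝ // ∀ i, |p i| ≤ π}

/-- The fibrewise form family on the closed cube for r15's `Thm711`: carrier Σ_{|p_j| ≤ π} 𝒦(p), ‖f‖², ⟨f, σ_k(p)f⟩ with the corrected
σ_k(p) at η = 1/n_k and cut-off M_k. [cite: BalabanImbrieJaffe1985, (7.1.22) p.324] -/
def sigmaFormClosed (d : ℕ) (s : Scale) : SigmaForm where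
  Plaq := Σ _p : ClosedMom d, TwoForm d
  normSq := fun x => normSq x.2.1
  sigma := fun x => (tensorInner x.2.1 (sigmaC s.n s.M x.1.1) x.2.1).re

end

end Literature.MathematicalPhysics.QuantumFieldTheory.BalabanImbrieJaffe1984to88.BIJ85SigmaClosedCube
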